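import Summits.QuantumFields.BalabanUV.T4Continuum.Support.NE7SquaredBumpGradient
import Summits.QuantumFields.BalabanUV.T4Continuum.Support.NE7GaugeFixOnPureGauges
import Summits.QuantumFields.BalabanUV.T4Continuum.Support.NE3NestedBlockMeanJensenHS
import Summits.QuantumFields.BalabanUV.T4Continuum.Support.NE3TopRadiusLetters

/-!
# NE7DivergenceOrthogonalAvgKernel — THE RIGIDITY OF `N(Q′(W))^⊥` (DIV): a skew torus 1-form `b` that is `hsR`-orthogonal to the pure gauges `D_W N(Q′(W))` has SMALL covariant
# divergence, `‖D_W† b‖² ≤ (C_div²∕M²)·‖b‖²`, `C_div² = card n·d·(2 + 2(d−1)(M−1)·M·x)²·(2∕tentMean2)²` (`M = L^{j+1}`; k-uniform on the class line `M²x ≤ θ`) — the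
# one estimate by which the minimal-norm section of the `N(Q′(W))`-orbits of `ker Q̄_W` differs from print's minimal-divergence section `T_A` WITHOUT losing a power of `M`
# (file 150 of the curved (APE), F221)

Cell `pub-balaban`, rung (B)+1 sub-cell t4, lineage `b2b-balaban-t4-ne7-p1` (CRUX PROVER NE7 #1 = OWNER of row NE7), generation 86; memo
`t4/b2b-balaban-t4-ne7-p1-g86/ORBIT-COMPARISON.md` §2.  Over F220 `NE7SquaredBumpGradient.sum_normSq_gaugeDir_sfixW_le` (the `ℓ²` gradient `∝ M^{d−2}` of g84's EXACT right inverse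
`sfixW` of `bmeanIterW`), row NE3's Jensen `NE3NestedBlockMeanJensenHS.sum_nhsNormSq_bmeanIterW_le_one` (`M^d·Σ nhs(bmeanIterW μ) ≤ Σ nhs μ`), `NE3TopRadiusLetters.E_le_half_of_levelSmall`,
`NE3CovariantBlockMean.bmeanIterW_skew_periodic`, F209 `NE7GaugeFixOnPureGauges.adjoint_gradOpK_apply` (`D_W† = covDiv` on the chart) and F192's carrier BY NAME.
WHY (duality).  `D_W† b ⊥ N(Q′(W))` (⟸ `b ⊥ D_W N(Q′(W))`); for ANY `φ` with `bmeanIterW φ = bmeanIterW (D_W† b)` the difference `D_W† b − φ` lies in `N(Q′(W))`, so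
`‖D_W† b‖² = ⟨D_W† b, φ⟩ = ⟨b, D_W φ⟩ ≤ ‖b‖·‖D_W φ‖`; with `φ = sfixW (bmeanIterW (D_W† b))`: `‖D_W φ‖² ≤ d·M^d·(2∕M + κ_x)²·(2∕tentMean2)²·card n·Σ_z nhs(bmeanIterW (D_W†b) z)
≤ (C_div²∕M²)·‖D_W† b‖²` (Jensen), hence `‖D_W† b‖ ≤ (C_div∕M)·‖b‖`.  Flat numerics (gen 86, kit j307748): `sup ‖div X‖∕‖X‖` over `div X ∈ N^⊥` = `5.2∕M` (d = 2), `6.5∕M` (d = 3).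
WHAT ([folklore]; 0 def, 0 sorry).  §1 `core_div` (pure-ℝ); §2 **`norm_sq_adjoint_gradOpK_le_of_orthogonal`** (the title).
HONEST FRAMING (page 1): finite-dimensional duality over landed kinematics at one background of the multi-level small-field class; nothing of Bałaban's asserted; (H1), (P_a), (KL-B),
(APE) on curved data NOT proved here; NOT ONE-STEP, NOT NE7; spine 0∕9; finite T⁴ rung (B)+1 — NOT infinite volume, NOT mass gap, NOT `BetaPertH`, NOT Clay.  Continuum YM on T⁴ ⇐
BetaPertH ∧ nine spine estimates (0/9 proved); BetaPertH ⇐ (D1) ∧ (D4) ∧ CAP+tail; G-an2-4 gates asym, D1 and NE2/3/4.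
-/

set_option autoImplicit false

open scoped BigOperators InnerProductSpace Matrix Matrix.Norms.L2Operator
open Finset

namespace Summit.QuantumFields.BalabanUV.T4Continuum.NE7DivergenceOrthogonalAvgKernel

open Literature.MathematicalPhysics.QuantumFieldTheory.Balaban1983to89
open B7Prop1Explicit B7Prop2Explicit UnitaryModel MatrixNorms
open T4AveragingDeficitWall (IsUnitaryCfg IsSkewDir SmallField)
open T4AveragingDeficitWallBoundary (periodBox IsPeriodicCfg)
open AveragingDeficitPeriodicCounting (IsPeriodicDir)
open AveragingDeficitMultiLevelPrep (tower LevelSmall)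
open BlockAveragePushDirGauge (gaugeDir)
open NE3HilbertSchmidtTorus
open NE3CovariantWeitzenbock (covDiv)
open NE3CurvedCornerGaugeSpace (covDiv_mem_skewAdjoint)
open NE3LandauOrbit (covDiv_add_period)
open NE3.PairLandauB8 (avgKernelGauges mem_avgKernelGauges_iff)
open NE3CovariantBlockMean (bmeanIterW bmeanIterW_skew_periodic)
open NE3FrameFreeSliceW (bmeanIterW_add bmeanIterW_smul)
open NE3CurvedProjectedLandau (tower_eq_pow_mul)
open NE3NestedBlockMeanJensenHS (sum_nhsNormSq_bmeanIterW_le_one)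
open NE3TopRadiusLetters (E_le_half_of_levelSmall)
open NE7BalabanSoftOperator
open NE7GaugeFixOnPureGauges (resS_mem_of_avgKernel adjoint_gradOpK_apply)
open NE7SquaredBumpNestedMeanOperator (tentMean2)
open NE7SquaredBumpNestedFix (sfixW bmeanIterW_sfixW_eq sfixW_mem_skewAdjoint sfixW_add_period)
open NE7SquaredBumpGradient (sum_normSq_gaugeDir_sfixW_le)

noncomputable section

variable {d : ℕ} {n : Type*} [Fintype n] [DecidableEq n]

/-! ## §1 The pure-real core of the duality -/

omit [Fintype n] [DecidableEq n] in
/-- `u² ≤ w·v`, `v² ≤ A·u²`, `0 ≤ u, A` ⇒ `u² ≤ A·w²`. [folklore] -/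
theorem core_div {u v w A : ℝ} (hu : 0 ≤ u) (hA : 0 ≤ A) (h1 : u ^ 2 ≤ w * v) (h2 : v ^ 2 ≤ A * u ^ 2) :
    u ^ 2 ≤ A * w ^ 2 := by
  by_cases hu0 : u = 0
  · rw [hu0, zero_pow two_ne_zero]; positivity
  have hu2 : 0 < u ^ 2 := by positivity
  have h3 : (u ^ 2) ^ 2 ≤ w ^ 2 * v ^ 2 := by
    calc (u ^ 2) ^ 2 ≤ (w * v) ^ 2 := pow_le_pow_left₀ (by positivity) h1 2
      _ = w ^ 2 * v ^ 2 := by ring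
  have h4 : (u ^ 2) ^ 2 ≤ w ^ 2 * (A * u ^ 2) := h3.trans (mul_le_mul_of_nonneg_left h2 (sq_nonneg w))
  have h5 : u ^ 2 * u ^ 2 ≤ (A * w ^ 2) * u ^ 2 := by nlinarith [h4]
  exact le_of_mul_le_mul_right h5 hu2

/-! ## §2 (DIV) on the carrier -/

section Carrier

variable [Nonempty n] {L N : ℕ} [NeZero N] (hL2 : 2 ≤ L) (j : ℕ) [NeZero (N * L ^ (j + 1))]
  {W : Site d → Fin d → (Matrix n n ℂ)ˣ} {x : ℝ} (hWu : IsUnitaryCfg W) (hWP : IsPeriodicCfg W ((N * L ^ (j + 1) : ℕ) : ℤ))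
  (hx : 0 ≤ x) (hs : LevelSmall d L j x) (hWx : SmallField W x)

include hL2 hWP hx hs hWx in
/-- **(DIV) — THE RIGIDITY OF `N(Q′(W))^⊥`.**  In the multi-level small-field class (`L ≥ 2`, unitary `(N·L^{j+1})`-periodic `W`, `0 ≤ x`, `LevelSmall d L j x`, `SmallField W x`), every
skew torus 1-form `b` with `⟪b, D_W μ⟫ = 0` for all `μ ∈ N(Q′(W))` satisfies
`‖D_W† b‖² ≤ (card n·d·(2 + 2(d−1)(M−1)·M·x)²·(2∕tentMean2)² ∕ M²)·‖b‖²`, `M = L^{j+1}`. [folklore] -/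
theorem norm_sq_adjoint_gradOpK_le_of_orthogonal (b : skewForms d n (N * L ^ (j + 1)))
    (horth : ∀ (μ : Site d → Matrix n n ℂ) (hμ : μ ∈ avgKernelGauges (d := d) (n := n) L N (j + 1) W),
      ⟪b, gradOpK hWu (N * L ^ (j + 1)) ⟨resS (N * L ^ (j + 1)) μ, resS_mem_of_avgKernel hμ⟩⟫_ℝ = 0) :
    ‖(LinearMap.adjoint (𝕜 := ℝ) (E := skewSecs d n (N * L ^ (j + 1))) (F := skewForms d n (N * L ^ (j + 1))) (gradOpK hWu (N * L ^ (j + 1)))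
        : skewForms d n (N * L ^ (j + 1)) →ₗ[ℝ] skewSecs d n (N * L ^ (j + 1))) b‖ ^ 2
      ≤ ((Fintype.card n : ℝ) * d * (2 + 2 * (((d : ℝ) - 1) * (((L : ℝ) ^ (j + 1)) - 1) * x) * (L : ℝ) ^ (j + 1)) ^ 2
            * (2 / tentMean2 d (L ^ (j + 1))) ^ 2 / ((L : ℝ) ^ (j + 1)) ^ 2) * ‖b‖ ^ 2 := by
  have hL1 : 1 ≤ L := by omega
  have hP : 1 ≤ N * L ^ (j + 1) := Nat.one_le_iff_ne_zero.mpr (NeZero.ne _)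
  have hM0 : (0 : ℝ) < (L : ℝ) ^ (j + 1) := by positivity
  have htow : (tower L N (j + 1) : ℕ) = N * L ^ (j + 1) := by rw [tower_eq_pow_mul, Nat.mul_comm]
  have hWP' : IsPeriodicCfg W ((tower L N (j + 1) : ℕ) : ℤ) := by rw [htow]; exact hWP
  set Gt := (LinearMap.adjoint (𝕜 := ℝ) (E := skewSecs d n (N * L ^ (j + 1))) (F := skewForms d n (N * L ^ (j + 1))) (gradOpK hWu (N * L ^ (j + 1))) : skewForms d n (N * L ^ (j + 1)) →ₗ[ℝ] skewSecs d n (N * L ^ (j + 1))) with hGt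
  -- the divergence `g`, its nested mean `τ`, and the smooth right inverse `φ`
  set g : Site d → Matrix n n ℂ := covDiv W (extF (N * L ^ (j + 1)) (b : Form d n (N * L ^ (j + 1)))) with hgdef
  have hgs : ∀ y, g y ∈ skewAdjoint (Matrix n n ℂ) := covDiv_mem_skewAdjoint hWu b.2
  have hgP : ∀ (y : Site d) (τ : Fin d), g (y + ((N * L ^ (j + 1) : ℕ) : ℤ) • e τ) = g y := covDiv_add_period hWP (isPeriodicDir_extF _ _)
  have hgP' : ∀ (y : Site d) (τ : Fin d), g (y + ((tower L N (j + 1) : ℕ) : ℤ) • e τ) = g y := by rw [htow]; exact hgP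
  have hGtb : Gt b = ⟨resS (N * L ^ (j + 1)) g, resS_mem_skewSecs hgs hgP⟩ := by
    rw [hGt, adjoint_gradOpK_apply hWu hWP hP b]
  set τ : Site d → Matrix n n ℂ := bmeanIterW L (j + 1) W g with hτdef
  obtain ⟨hτs, hτP⟩ := bmeanIterW_skew_periodic (M := N) hL1 j hWu hWP' hx hs hWx hgs hgP'
  have hE := E_le_half_of_levelSmall (d := d) hL1 j hx hs
  set φ : Site d → Matrix n n ℂ := sfixW hL2 j hWu hx hs hWx hE τ with hφdef
  have hφs : ∀ y, φ y ∈ skewAdjoint (Matrix n n ℂ) := sfixW_mem_skewAdjoint hL2 j hWu hx hs hWx hE hτs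
  have hφP : ∀ (y : Site d) (i : Fin d), φ (y + ((N * L ^ (j + 1) : ℕ) : ℤ) • e i) = φ y := by
    intro y i
    have h := sfixW_add_period hL2 j hWu hx hs hWx hE hWP' hτP y i
    rwa [htow] at h
  have hφmean : bmeanIterW L (j + 1) W φ = τ := bmeanIterW_sfixW_eq hL2 j hWu hx hs hWx hE τ
  -- `ν := g − φ ∈ N(Q′(W))`
  have hν : (fun y => g y - φ y) ∈ avgKernelGauges (d := d) (n := n) L N (j + 1) W := by
    refine mem_avgKernelGauges_iff.mpr ⟨fun y => (skewAdjoint _).sub_mem (hgs y) (hφs y), fun y i => ?_, ?_⟩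
    · show g (y + ((N * L ^ (j + 1) : ℕ) : ℤ) • e i) - φ (y + ((N * L ^ (j + 1) : ℕ) : ℤ) • e i) = g y - φ y
      rw [hgP y i, hφP y i]
    · have hfun : (fun y => g y - φ y) = g + (-1 : ℝ) • φ := by
        funext y; simp only [Pi.add_apply, Pi.neg_apply, neg_smul, one_smul, sub_eq_add_neg]
      rw [hfun, bmeanIterW_add, bmeanIterW_smul, hφmean, hτdef]
      funext z; simp
  -- the carrier sections
  set aφ : skewSecs d n (N * L ^ (j + 1)) := ⟨resS (N * L ^ (j + 1)) φ, resS_mem_skewSecs hφs hφP⟩ with haφ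
  have hsplit : Gt b = aφ + ⟨resS (N * L ^ (j + 1)) (fun y => g y - φ y), resS_mem_of_avgKernel hν⟩ := by
    rw [hGtb]; apply Subtype.ext
    show resS (N * L ^ (j + 1)) g = resS (N * L ^ (j + 1)) φ + resS (N * L ^ (j + 1)) (fun y => g y - φ y)
    rw [← resS_add]; congr 1; funext y; abel
  -- duality: `‖G†b‖² = ⟨b, G aφ⟩`
  have hdual : ‖Gt b‖ ^ 2 = ⟪b, gradOpK hWu (N * L ^ (j + 1)) aφ⟫_ℝ := by
    rw [← real_inner_self_eq_norm_sq]
    calc ⟪Gt b, Gt b⟫_ℝ = ⟪Gt b, aφ + ⟨resS (N * L ^ (j + 1)) (fun y => g y - φ y), resS_mem_of_avgKernel hν⟩⟫_ℝ := by rw [← hsplit]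
      _ = ⟪Gt b, aφ⟫_ℝ + ⟪Gt b, ⟨resS (N * L ^ (j + 1)) (fun y => g y - φ y), resS_mem_of_avgKernel hν⟩⟫_ℝ := inner_add_right _ _ _
      _ = ⟪b, gradOpK hWu (N * L ^ (j + 1)) aφ⟫_ℝ
            + ⟪b, gradOpK hWu (N * L ^ (j + 1)) ⟨resS (N * L ^ (j + 1)) (fun y => g y - φ y), resS_mem_of_avgKernel hν⟩⟫_ℝ := by
          rw [hGt, LinearMap.adjoint_inner_left, LinearMap.adjoint_inner_left]
      _ = ⟪b, gradOpK hWu (N * L ^ (j + 1)) aφ⟫_ℝ := by rw [horth _ hν, add_zero]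
  have h1 : ‖Gt b‖ ^ 2 ≤ ‖b‖ * ‖gradOpK hWu (N * L ^ (j + 1)) aφ‖ :=
    hdual.trans_le (real_inner_le_norm _ _)
  -- the gradient of `φ`
  set K : ℝ := (d : ℝ) * ((L : ℝ) ^ (j + 1)) ^ d * (2 / ((L : ℝ) ^ (j + 1)) + 2 * (((d : ℝ) - 1) * (((L : ℝ) ^ (j + 1)) - 1) * x)) ^ 2
      * (2 / tentMean2 d (L ^ (j + 1))) ^ 2 with hK
  have hK0 : 0 ≤ K := by positivity
  have hgrad : ‖gradOpK hWu (N * L ^ (j + 1)) aφ‖ ^ 2 ≤ K * ∑ z ∈ periodBox (d := d) N, ‖τ z‖ ^ 2 := by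
    have e1 : ‖gradOpK hWu (N * L ^ (j + 1)) aφ‖ ^ 2 = ∑ y ∈ periodBox (d := d) (N * L ^ (j + 1)), ∑ κ : Fin d, nhsNormSq (gaugeDir W φ y κ) := by
      rw [← norm_sq_DW_resS W (N * L ^ (j + 1)) hφP]; rfl
    rw [e1]
    calc ∑ y ∈ periodBox (d := d) (N * L ^ (j + 1)), ∑ κ : Fin d, nhsNormSq (gaugeDir W φ y κ)
        ≤ ∑ y ∈ periodBox (d := d) (N * L ^ (j + 1)), ∑ κ : Fin d, ‖gaugeDir W φ y κ‖ ^ 2 :=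
          Finset.sum_le_sum fun y _ => Finset.sum_le_sum fun κ _ => nhsNormSq_le_opNorm_sq _
      _ ≤ K * ∑ z ∈ periodBox (d := d) N, ‖τ z‖ ^ 2 := by
          have h := sum_normSq_gaugeDir_sfixW_le hL2 j hWu hx hs hWx hE N τ
          rw [Nat.mul_comm (L ^ (j + 1)) N] at h
          exact h
  -- Jensen: `M^d·Σ_z nhs(τ z) ≤ Σ_y nhs(g y) = ‖G†b‖²`, and `‖τ z‖² ≤ card n·nhs(τ z)`
  have hJ : ((L : ℝ) ^ (j + 1)) ^ d * ∑ z ∈ periodBox (d := d) N, ‖τ z‖ ^ 2 ≤ (Fintype.card n : ℝ) * ‖Gt b‖ ^ 2 := by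
    have hj := sum_nhsNormSq_bmeanIterW_le_one hL1 j hWu hx hs hWx g N
    rw [Nat.mul_comm (L ^ (j + 1)) N, ← Finset.mul_sum] at hj
    have e2 : ‖Gt b‖ ^ 2 = ∑ y ∈ periodBox (d := d) (N * L ^ (j + 1)), nhsNormSq (g y) := by
      rw [hGtb]; exact norm_sq_resS (N * L ^ (j + 1)) g
    rw [e2, Finset.mul_sum]
    calc ∑ z ∈ periodBox (d := d) N, ((L : ℝ) ^ (j + 1)) ^ d * ‖τ z‖ ^ 2
        ≤ ∑ z ∈ periodBox (d := d) N, ((L : ℝ) ^ (j + 1)) ^ d * ((Fintype.card n : ℝ) * nhsNormSq (τ z)) :=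
          Finset.sum_le_sum fun z _ => mul_le_mul_of_nonneg_left (opNorm_sq_le_card_mul_nhsNormSq _) (by positivity)
      _ = (Fintype.card n : ℝ) * (((L : ℝ) ^ (j + 1)) ^ d * ∑ z ∈ periodBox (d := d) N, nhsNormSq (bmeanIterW L (j + 1) W g z)) := by
          rw [Finset.mul_sum, Finset.mul_sum]; refine Finset.sum_congr rfl fun z _ => ?_; rw [hτdef]; ring
      _ ≤ (Fintype.card n : ℝ) * ∑ y ∈ periodBox (d := d) (N * L ^ (j + 1)), nhsNormSq (g y) := mul_le_mul_of_nonneg_left hj (Nat.cast_nonneg _)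
  -- assemble: `v² ≤ A·u²` with `A = K·card n ∕ M^d`
  have h2 : ‖gradOpK hWu (N * L ^ (j + 1)) aφ‖ ^ 2 ≤ (K * (Fintype.card n : ℝ) / ((L : ℝ) ^ (j + 1)) ^ d) * ‖Gt b‖ ^ 2 := by
    have hMd : (0 : ℝ) < ((L : ℝ) ^ (j + 1)) ^ d := by positivity
    have h3 : ∑ z ∈ periodBox (d := d) N, ‖τ z‖ ^ 2 ≤ (Fintype.card n : ℝ) * ‖Gt b‖ ^ 2 / ((L : ℝ) ^ (j + 1)) ^ d := by
      rw [le_div_iff₀ hMd]; linarith [hJ]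
    calc ‖gradOpK hWu (N * L ^ (j + 1)) aφ‖ ^ 2 ≤ K * ∑ z ∈ periodBox (d := d) N, ‖τ z‖ ^ 2 := hgrad
      _ ≤ K * ((Fintype.card n : ℝ) * ‖Gt b‖ ^ 2 / ((L : ℝ) ^ (j + 1)) ^ d) := mul_le_mul_of_nonneg_left h3 hK0
      _ = (K * (Fintype.card n : ℝ) / ((L : ℝ) ^ (j + 1)) ^ d) * ‖Gt b‖ ^ 2 := by ring
  have hA0 : 0 ≤ K * (Fintype.card n : ℝ) / ((L : ℝ) ^ (j + 1)) ^ d := by positivity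
  have hfin := core_div (norm_nonneg _) hA0 h1 h2
  refine hfin.trans (le_of_eq ?_)
  -- the constant: `K·card n ∕ M^d = card n·d·(2 + κ·M)²·(2∕tentMean2)² ∕ M²`
  rw [hK]
  field_simp

end Carrier

end

end Summit.QuantumFields.BalabanUV.T4Continuum.NE7DivergenceOrthogonalAvgKernel
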